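import Mathlib
import Literature.Analysis.FluidPDE.VectorCalculus
import Literature.Analysis.FluidPDE.TaoAveragedNondegeneracy

/-!
# The self-strand bound for the endgame of line `zero-accretion-selection` (tools stub `stub_tameVerticalToolsB`)

The coherent-bending cancellation behind `stub_tameVerticalSubcritical` (crux `SkeletonEquilibrium`, thesis
`FilamentSkeletonRss`; lead a1, memo §2bis). For a `C²` curve `X` and a base parameter `τ₀` put
`T₀ = X′(τ₀)`, `c = X″(τ₀)`, `a(s) = X′(τ₀+s) − T₀ = ∫₀ˢ X″`, `b(s) = X(τ₀+s) − X(τ₀) − sT₀ = ∫₀ˢ a`.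
Under the outer-scale control `‖X″(τ₀+u)‖ ≤ M/ℓ`, `‖X″(τ₀+u) − X″(τ₀)‖ ≤ (M|u|/ℓ + ε)/ℓ` (`|u| ≤ |s|`)
one has `a = s c + D₁`, `b = (s²/2)c + D₂` with `‖D₁‖ ≤ (Ms²/(2ℓ) + ε|s|)/ℓ`,
`‖D₂‖ ≤ (M|s|³/(6ℓ) + εs²/2)/ℓ`, and the triple product `⟪T₀ × a, b⟫` — up to sign the numerator
`⟪X′(σ) × r, T₀⟫` of the axial-strain integrand on the self strand — loses its `c ∧ c` part:
`|⟪T₀ × a, b⟫| ≤ ‖T₀‖(|s|‖c‖‖D₂‖ + (s²/2)‖D₁‖‖c‖ + ‖D₁‖‖D₂‖)` (`selfStrand_triple_le`).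
-/

noncomputable section

open Literature.Analysis.FluidPDE Literature.Analysis.FluidPDE.Tao2016 MeasureTheory intervalIntegral
open scoped RealInnerProductSpace InnerProductSpace

namespace Summit.NavierStokesRegularity.NavierStokesRegularity.Theorems.SkeletonEquilibrium.ZeroAccretionSelection
set_option linter.dupNamespace false

/-- Hadamard: `|⟪u × v, w⟫| ≤ ‖u‖ ‖v‖ ‖w‖`. [folklore] -/
theorem abs_triple_le (u v w : EuclideanSpace ℝ (Fin 3)) : |⟪cross u v, w⟫| ≤ ‖u‖ * ‖v‖ * ‖w‖ := by
  have h1 := abs_real_inner_le_norm (cross u v) w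
  have h2 : ‖cross u v‖ ≤ ‖u‖ * ‖v‖ := by
    rw [norm_cross]
    have : Real.sin (InnerProductGeometry.angle u v) ≤ 1 := Real.sin_le_one _
    have : 0 ≤ ‖u‖ * ‖v‖ := by positivity
    nlinarith
  calc |⟪cross u v, w⟫| ≤ ‖cross u v‖ * ‖w‖ := h1
    _ ≤ ‖u‖ * ‖v‖ * ‖w‖ := by gcongr

/-- The `c ∧ c` cancellation: `det(T₀, s c + D₁, (s²/2) c + D₂) = s det(T₀, c, D₂) + (s²/2) det(T₀, D₁, c)
+ det(T₀, D₁, D₂)`. [folklore] -/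
theorem triple_expand (T₀ c D₁ D₂ : EuclideanSpace ℝ (Fin 3)) (s : ℝ) :
    ⟪cross T₀ (s • c + D₁), (s ^ 2 / 2) • c + D₂⟫ =
      s * ⟪cross T₀ c, D₂⟫ + (s ^ 2 / 2) * ⟪cross T₀ D₁, c⟫ + ⟪cross T₀ D₁, D₂⟫ := by
  simp only [real_inner_fin3, cross_apply_zero, cross_apply_one, cross_apply_two, PiLp.add_apply,
    PiLp.smul_apply, smul_eq_mul]
  ring

/-- **Self-strand determinant bound (algebraic form).** With `a = s c + D₁`, `b = (s²/2) c + D₂`: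
`|⟪T₀ × a, b⟫| ≤ ‖T₀‖ (|s| ‖c‖ ‖D₂‖ + (s²/2) ‖D₁‖ ‖c‖ + ‖D₁‖ ‖D₂‖)`. [folklore] -/
theorem abs_triple_self_le (T₀ c D₁ D₂ : EuclideanSpace ℝ (Fin 3)) (s : ℝ) :
    |⟪cross T₀ (s • c + D₁), (s ^ 2 / 2) • c + D₂⟫| ≤
      ‖T₀‖ * (|s| * ‖c‖ * ‖D₂‖ + s ^ 2 / 2 * ‖D₁‖ * ‖c‖ + ‖D₁‖ * ‖D₂‖) := by
  rw [triple_expand]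
  have h1 := abs_triple_le T₀ c D₂
  have h2 := abs_triple_le T₀ D₁ c
  have h3 := abs_triple_le T₀ D₁ D₂
  calc |s * ⟪cross T₀ c, D₂⟫ + s ^ 2 / 2 * ⟪cross T₀ D₁, c⟫ + ⟪cross T₀ D₁, D₂⟫|
      ≤ |s * ⟪cross T₀ c, D₂⟫| + |s ^ 2 / 2 * ⟪cross T₀ D₁, c⟫| + |⟪cross T₀ D₁, D₂⟫| := abs_add_three _ _ _
    _ = |s| * |⟪cross T₀ c, D₂⟫| + s ^ 2 / 2 * |⟪cross T₀ D₁, c⟫| + |⟪cross T₀ D₁, D₂⟫| := by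
        rw [abs_mul, abs_mul, abs_of_nonneg (by positivity : (0:ℝ) ≤ s ^ 2 / 2)]
    _ ≤ |s| * (‖T₀‖ * ‖c‖ * ‖D₂‖) + s ^ 2 / 2 * (‖T₀‖ * ‖D₁‖ * ‖c‖) + ‖T₀‖ * ‖D₁‖ * ‖D₂‖ := by
        gcongr
    _ = ‖T₀‖ * (|s| * ‖c‖ * ‖D₂‖ + s ^ 2 / 2 * ‖D₁‖ * ‖c‖ + ‖D₁‖ * ‖D₂‖) := by ring

/-- **First integral bound.** If `g : ℝ → E` is continuous and `‖g u‖ ≤ (M|u|/ℓ + ε)/ℓ` for `u` between `0`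
and `s`, then `‖∫₀ˢ g‖ ≤ (M s²/(2ℓ) + ε|s|)/ℓ`. [folklore] -/
theorem norm_integral_defect_le {E : Type*} [NormedAddCommGroup E] [NormedSpace ℝ E] {g : ℝ → E}
    (hg : Continuous g) {M ℓ ε s : ℝ} (hℓ : 0 < ℓ) (hM : 0 ≤ M) (hε : 0 ≤ ε)
    (hb : ∀ u, |u| ≤ |s| → ‖g u‖ ≤ (M * |u| / ℓ + ε) / ℓ) :
    ‖∫ u in (0:ℝ)..s, g u‖ ≤ (M * s ^ 2 / (2 * ℓ) + ε * |s|) / ℓ := by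
  -- bound the integrand by the monotone majorant evaluated at |s| is too crude; integrate the majorant
  have key : ‖∫ u in (0:ℝ)..s, g u‖ ≤ |∫ u in (0:ℝ)..s, (M * |u| / ℓ + ε) / ℓ| := by
    refine intervalIntegral.norm_integral_le_abs_integral_norm.trans ?_
    -- ∫ ‖g‖ ≤ ∫ majorant (both over the same oriented interval): compare via monotonicity on Ι 0 s
    have h1 : |∫ u in (0:ℝ)..s, ‖g u‖| ≤ |∫ u in (0:ℝ)..s, (M * |u| / ℓ + ε) / ℓ| := by
      rw [intervalIntegral.abs_integral_eq_abs_integral_uIoc, intervalIntegral.abs_integral_eq_abs_integral_uIoc]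
      have hnn1 : 0 ≤ ∫ u in Set.uIoc 0 s, ‖g u‖ := setIntegral_nonneg measurableSet_uIoc fun _ _ => norm_nonneg _
      have hnn2 : 0 ≤ ∫ u in Set.uIoc 0 s, (M * |u| / ℓ + ε) / ℓ :=
        setIntegral_nonneg measurableSet_uIoc fun _ _ => by positivity
      rw [abs_of_nonneg hnn1, abs_of_nonneg hnn2]
      refine setIntegral_mono_on ?_ ?_ measurableSet_uIoc ?_
      · exact (hg.norm.integrableOn_Icc).mono_set Set.uIoc_subset_uIcc |>.mono_set (le_refl _)
      · exact (Continuous.integrableOn_Icc (by fun_prop)).mono_set Set.uIoc_subset_uIcc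
      · intro u hu
        apply hb
        rcases Set.mem_uIoc.1 hu with ⟨h0, h1⟩ | ⟨h0, h1⟩
        · rw [abs_of_pos h0]; exact le_trans h1 (le_abs_self s)
        · rw [abs_of_nonpos h1]
          have : -u < -s + 0 := by linarith
          calc -u ≤ -s := by linarith
            _ ≤ |s| := neg_le_abs s
    exact h1
  refine key.trans (le_of_eq ?_)
  -- compute the majorant integral: ∫₀ˢ (M|u|/ℓ + ε)/ℓ = (M s|s|/(2ℓ) + ε s)/ℓ, absolute value as claimed
  have hcomp : ∫ u in (0:ℝ)..s, (M * |u| / ℓ + ε) / ℓ = (M * (s * |s|) / (2 * ℓ) + ε * s) / ℓ := by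
    rcases le_or_gt 0 s with hs | hs
    · have : ∫ u in (0:ℝ)..s, (M * |u| / ℓ + ε) / ℓ = ∫ u in (0:ℝ)..s, (M / ℓ ^ 2) * u + ε / ℓ := by
        refine intervalIntegral.integral_congr fun u hu => ?_
        rw [Set.uIcc_of_le hs] at hu
        simp only [abs_of_nonneg hu.1]
        ring
      have I1 : IntervalIntegrable (fun u : ℝ => (M / ℓ ^ 2) * u) volume 0 s :=
        (by fun_prop : Continuous fun u : ℝ => (M / ℓ ^ 2) * u).intervalIntegrable 0 s
      have I2 : IntervalIntegrable (fun _ : ℝ => ε / ℓ) volume 0 s := continuous_const.intervalIntegrable 0 s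
      rw [this, intervalIntegral.integral_add I1 I2, intervalIntegral.integral_const_mul,
        integral_id, intervalIntegral.integral_const, abs_of_nonneg hs, smul_eq_mul]
      ring
    · have : ∫ u in (0:ℝ)..s, (M * |u| / ℓ + ε) / ℓ = ∫ u in (0:ℝ)..s, (-(M / ℓ ^ 2)) * u + ε / ℓ := by
        refine intervalIntegral.integral_congr fun u hu => ?_
        rw [Set.uIcc_of_ge hs.le] at hu
        simp only [abs_of_nonpos hu.2]
        ring
      have I1 : IntervalIntegrable (fun u : ℝ => (-(M / ℓ ^ 2)) * u) volume 0 s :=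
        (by fun_prop : Continuous fun u : ℝ => (-(M / ℓ ^ 2)) * u).intervalIntegrable 0 s
      have I2 : IntervalIntegrable (fun _ : ℝ => ε / ℓ) volume 0 s := continuous_const.intervalIntegrable 0 s
      rw [this, intervalIntegral.integral_add I1 I2, intervalIntegral.integral_const_mul,
        integral_id, intervalIntegral.integral_const, abs_of_neg hs, smul_eq_mul]
      ring
  rw [hcomp]
  have hsabs : s * |s| = |s| * |s| ∨ s * |s| = -(|s| * |s|) := by
    rcases le_or_gt 0 s with hs | hs
    · left; rw [abs_of_nonneg hs]
    · right; rw [abs_of_neg hs]; ring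
  rcases le_or_gt 0 s with hs | hs
  · rw [abs_of_nonneg hs]
    rw [abs_of_nonneg (by positivity)]
    ring_nf
  · rw [abs_of_neg hs]
    have e : (M * (s * -s) / (2 * ℓ) + ε * s) / ℓ = -((M * s ^ 2 / (2 * ℓ) + ε * -s) / ℓ) := by
      field_simp; ring
    rw [e, abs_neg, abs_of_nonneg]
    have : 0 ≤ -s := by linarith
    positivity

/-- **Second integral bound.** If `D : ℝ → E` is continuous and `‖D u‖ ≤ (M u²/(2ℓ) + ε|u|)/ℓ` for `u` between
`0` and `s`, then `‖∫₀ˢ D‖ ≤ (M|s|³/(6ℓ) + ε s²/2)/ℓ`. [folklore] -/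
theorem norm_integral_defect₂_le {E : Type*} [NormedAddCommGroup E] [NormedSpace ℝ E] {D : ℝ → E}
    (hD : Continuous D) {M ℓ ε s : ℝ} (hℓ : 0 < ℓ) (hM : 0 ≤ M) (hε : 0 ≤ ε)
    (hb : ∀ u, |u| ≤ |s| → ‖D u‖ ≤ (M * u ^ 2 / (2 * ℓ) + ε * |u|) / ℓ) :
    ‖∫ u in (0:ℝ)..s, D u‖ ≤ (M * |s| ^ 3 / (6 * ℓ) + ε * s ^ 2 / 2) / ℓ := by
  have key : ‖∫ u in (0:ℝ)..s, D u‖ ≤ |∫ u in (0:ℝ)..s, (M * u ^ 2 / (2 * ℓ) + ε * |u|) / ℓ| := by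
    refine intervalIntegral.norm_integral_le_abs_integral_norm.trans ?_
    rw [intervalIntegral.abs_integral_eq_abs_integral_uIoc, intervalIntegral.abs_integral_eq_abs_integral_uIoc]
    have hnn1 : 0 ≤ ∫ u in Set.uIoc 0 s, ‖D u‖ := setIntegral_nonneg measurableSet_uIoc fun _ _ => norm_nonneg _
    have hnn2 : 0 ≤ ∫ u in Set.uIoc 0 s, (M * u ^ 2 / (2 * ℓ) + ε * |u|) / ℓ :=
      setIntegral_nonneg measurableSet_uIoc fun _ _ => by positivity
    rw [abs_of_nonneg hnn1, abs_of_nonneg hnn2]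
    refine setIntegral_mono_on ?_ ?_ measurableSet_uIoc ?_
    · exact (hD.norm.integrableOn_Icc).mono_set Set.uIoc_subset_uIcc
    · exact (Continuous.integrableOn_Icc (by fun_prop)).mono_set Set.uIoc_subset_uIcc
    · intro u hu
      apply hb
      rcases Set.mem_uIoc.1 hu with ⟨h0, h1⟩ | ⟨h0, h1⟩
      · rw [abs_of_pos h0]; exact le_trans h1 (le_abs_self s)
      · rw [abs_of_nonpos h1]
        calc -u ≤ -s := by linarith
          _ ≤ |s| := neg_le_abs s
  refine key.trans (le_of_eq ?_)
  rcases le_or_gt 0 s with hs | hs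
  · have : ∫ u in (0:ℝ)..s, (M * u ^ 2 / (2 * ℓ) + ε * |u|) / ℓ =
        ∫ u in (0:ℝ)..s, (M / (2 * ℓ ^ 2)) * u ^ 2 + (ε / ℓ) * u := by
      refine intervalIntegral.integral_congr fun u hu => ?_
      rw [Set.uIcc_of_le hs] at hu
      simp only [abs_of_nonneg hu.1]
      ring
    have I1 : IntervalIntegrable (fun u : ℝ => (M / (2 * ℓ ^ 2)) * u ^ 2) volume 0 s :=
      (by fun_prop : Continuous fun u : ℝ => (M / (2 * ℓ ^ 2)) * u ^ 2).intervalIntegrable 0 s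
    have I2 : IntervalIntegrable (fun u : ℝ => (ε / ℓ) * u) volume 0 s :=
      (by fun_prop : Continuous fun u : ℝ => (ε / ℓ) * u).intervalIntegrable 0 s
    rw [this, intervalIntegral.integral_add I1 I2, intervalIntegral.integral_const_mul,
      intervalIntegral.integral_const_mul, integral_pow, integral_id, abs_of_nonneg hs]
    have e : M / (2 * ℓ ^ 2) * ((s ^ (2 + 1) - 0 ^ (2 + 1)) / (((2:ℕ) : ℝ) + 1)) + ε / ℓ * ((s ^ 2 - 0 ^ 2) / 2) =
        (M * s ^ 3 / (6 * ℓ) + ε * s ^ 2 / 2) / ℓ := by push_cast; ring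
    rw [e, abs_of_nonneg (by positivity)]
  · have : ∫ u in (0:ℝ)..s, (M * u ^ 2 / (2 * ℓ) + ε * |u|) / ℓ =
        ∫ u in (0:ℝ)..s, (M / (2 * ℓ ^ 2)) * u ^ 2 + (-(ε / ℓ)) * u := by
      refine intervalIntegral.integral_congr fun u hu => ?_
      rw [Set.uIcc_of_ge hs.le] at hu
      simp only [abs_of_nonpos hu.2]
      ring
    have I1 : IntervalIntegrable (fun u : ℝ => (M / (2 * ℓ ^ 2)) * u ^ 2) volume 0 s :=
      (by fun_prop : Continuous fun u : ℝ => (M / (2 * ℓ ^ 2)) * u ^ 2).intervalIntegrable 0 s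
    have I2 : IntervalIntegrable (fun u : ℝ => (-(ε / ℓ)) * u) volume 0 s :=
      (by fun_prop : Continuous fun u : ℝ => (-(ε / ℓ)) * u).intervalIntegrable 0 s
    rw [this, intervalIntegral.integral_add I1 I2, intervalIntegral.integral_const_mul,
      intervalIntegral.integral_const_mul, integral_pow, integral_id, abs_of_neg hs]
    have e : M / (2 * ℓ ^ 2) * ((s ^ (2 + 1) - 0 ^ (2 + 1)) / (((2:ℕ) : ℝ) + 1)) + -(ε / ℓ) * ((s ^ 2 - 0 ^ 2) / 2) =
        -((M * (-s) ^ 3 / (6 * ℓ) + ε * s ^ 2 / 2) / ℓ) := by push_cast; ring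
    rw [e, abs_neg, abs_of_nonneg]
    have : 0 ≤ -s := by linarith
    positivity

/-- FTC for the tangent: for a `C²` curve, `X′(τ₀+s) − X′(τ₀) = ∫₀ˢ X″(τ₀+u) du`
(`X″ = deriv (deriv X)`). [folklore] -/
theorem deriv_sub_deriv_eq_integral {E : Type*} [NormedAddCommGroup E] [NormedSpace ℝ E] [CompleteSpace E]
    {X : ℝ → E} (hX : ContDiff ℝ 2 X) (τ₀ s : ℝ) :
    deriv X (τ₀ + s) - deriv X τ₀ = ∫ u in (0:ℝ)..s, deriv (deriv X) (τ₀ + u) := by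
  have hd : Differentiable ℝ (deriv X) := hX.differentiable_deriv_two
  have hc : Continuous (deriv (deriv X)) := by
    have h2 : ContDiff ℝ (1 + 1) X := by rw [one_add_one_eq_two]; exact hX
    exact h2.deriv'.continuous_deriv_one
  rw [intervalIntegral.integral_comp_add_left (fun u => deriv (deriv X) u) τ₀]
  rw [intervalIntegral.integral_deriv_eq_sub (fun x _ => hd x) (hc.intervalIntegrable _ _)]
  simp

/-- FTC for the position: `X(τ₀+s) − X(τ₀) − s • X′(τ₀) = ∫₀ˢ (X′(τ₀+u) − X′(τ₀)) du`. [folklore] -/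
theorem pos_sub_eq_integral {E : Type*} [NormedAddCommGroup E] [NormedSpace ℝ E] [CompleteSpace E]
    {X : ℝ → E} (hX : ContDiff ℝ 2 X) (τ₀ s : ℝ) :
    X (τ₀ + s) - X τ₀ - s • deriv X τ₀ = ∫ u in (0:ℝ)..s, (deriv X (τ₀ + u) - deriv X τ₀) := by
  have hd : Differentiable ℝ X := hX.differentiable (by norm_num)
  have hc : Continuous (deriv X) := hX.continuous_deriv (by norm_num)
  have I1 : IntervalIntegrable (fun u => deriv X (τ₀ + u)) volume 0 s :=
    (hc.comp (continuous_const.add continuous_id)).intervalIntegrable 0 s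
  have I2 : IntervalIntegrable (fun _ => deriv X τ₀) volume 0 s := continuous_const.intervalIntegrable 0 s
  rw [intervalIntegral.integral_sub I1 I2]
  rw [intervalIntegral.integral_comp_add_left (fun u => deriv X u) τ₀]
  rw [intervalIntegral.integral_deriv_eq_sub (fun x _ => hd x) (hc.intervalIntegrable _ _),
    intervalIntegral.integral_const]
  simp only [add_zero, sub_zero]

/-- **Self-strand determinant bound for a `C²` curve under outer-scale control.** With `T₀ = X′(τ₀)`,
if `‖X″(τ₀+u)‖ ≤ M/ℓ` and `‖X″(τ₀+u) − X″(τ₀)‖ ≤ (M|u|/ℓ + ε)/ℓ` for `|u| ≤ |s|`, then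
`|⟪T₀ × (X′(τ₀+s) − T₀), X(τ₀+s) − X(τ₀) − sT₀⟫| ≤ ‖T₀‖(|s|(M/ℓ)B₂ + (s²/2)B₁(M/ℓ) + B₁B₂)`,
`B₁ = (Ms²/(2ℓ) + ε|s|)/ℓ`, `B₂ = (M|s|³/(6ℓ) + εs²/2)/ℓ`. [folklore] -/
theorem selfStrand_triple_le {X : ℝ → EuclideanSpace ℝ (Fin 3)} (hX : ContDiff ℝ 2 X) (τ₀ s : ℝ)
    {M ℓ ε : ℝ} (hℓ : 0 < ℓ) (hM : 0 ≤ M) (hε : 0 ≤ ε)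
    (hC1 : ∀ u, |u| ≤ |s| → ‖deriv (deriv X) (τ₀ + u)‖ ≤ M / ℓ)
    (hC2 : ∀ u, |u| ≤ |s| → ‖deriv (deriv X) (τ₀ + u) - deriv (deriv X) τ₀‖ ≤ (M * |u| / ℓ + ε) / ℓ) :
    |⟪cross (deriv X τ₀) (deriv X (τ₀ + s) - deriv X τ₀), X (τ₀ + s) - X τ₀ - s • deriv X τ₀⟫| ≤
      ‖deriv X τ₀‖ * (|s| * (M / ℓ) * ((M * |s| ^ 3 / (6 * ℓ) + ε * s ^ 2 / 2) / ℓ) +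
        s ^ 2 / 2 * ((M * s ^ 2 / (2 * ℓ) + ε * |s|) / ℓ) * (M / ℓ) +
        ((M * s ^ 2 / (2 * ℓ) + ε * |s|) / ℓ) * ((M * |s| ^ 3 / (6 * ℓ) + ε * s ^ 2 / 2) / ℓ)) := by
  set c := deriv (deriv X) τ₀ with hc
  set d : ℝ → EuclideanSpace ℝ (Fin 3) := fun u => deriv (deriv X) (τ₀ + u) - c with hd
  set D₁ : ℝ → EuclideanSpace ℝ (Fin 3) := fun v => ∫ u in (0:ℝ)..v, d u with hD₁
  set D₂ : EuclideanSpace ℝ (Fin 3) := ∫ v in (0:ℝ)..s, D₁ v with hD₂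
  have hcont2 : Continuous (deriv (deriv X)) := by
    have h2 : ContDiff ℝ (1 + 1) X := by rw [one_add_one_eq_two]; exact hX
    exact h2.deriv'.continuous_deriv_one
  have hdcont : Continuous d := by
    rw [hd]; exact (hcont2.comp (continuous_const.add continuous_id)).sub continuous_const
  have hD₁cont : Continuous D₁ := by
    rw [hD₁]
    exact intervalIntegral.continuous_primitive (fun a b => hdcont.intervalIntegrable a b) 0
  -- a(v) = v c + D₁ v
  have ha : ∀ v, deriv X (τ₀ + v) - deriv X τ₀ = v • c + D₁ v := by
    intro v
    rw [deriv_sub_deriv_eq_integral hX τ₀ v, hD₁]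
    have : (fun u => deriv (deriv X) (τ₀ + u)) = fun u => c + d u := by
      funext u; simp [hd]
    simp only [this]
    have I1 : IntervalIntegrable (fun _ : ℝ => c) volume 0 v := continuous_const.intervalIntegrable 0 v
    have I2 : IntervalIntegrable (fun u : ℝ => d u) volume 0 v := hdcont.intervalIntegrable 0 v
    rw [intervalIntegral.integral_add I1 I2, intervalIntegral.integral_const, sub_zero]
  -- b(s) = (s²/2) c + D₂
  have hb : X (τ₀ + s) - X τ₀ - s • deriv X τ₀ = (s ^ 2 / 2) • c + D₂ := by
    rw [pos_sub_eq_integral hX τ₀ s]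
    have : (fun u => deriv X (τ₀ + u) - deriv X τ₀) = fun u => u • c + D₁ u := funext ha
    have I1 : IntervalIntegrable (fun u : ℝ => u • c) volume 0 s :=
      (continuous_id.smul continuous_const).intervalIntegrable 0 s
    have I2 : IntervalIntegrable (fun u : ℝ => D₁ u) volume 0 s := hD₁cont.intervalIntegrable 0 s
    rw [this, intervalIntegral.integral_add I1 I2, hD₂]
    congr 1
    rw [intervalIntegral.integral_smul_const, integral_id]
    simp
  -- bounds on D₁, D₂
  have hB₁ : ∀ v, |v| ≤ |s| → ‖D₁ v‖ ≤ (M * v ^ 2 / (2 * ℓ) + ε * |v|) / ℓ := by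
    intro v hv
    rw [hD₁]
    exact norm_integral_defect_le hdcont hℓ hM hε fun u hu => by
      rw [hd]; exact hC2 u (le_trans hu hv)
  have hB₂ : ‖D₂‖ ≤ (M * |s| ^ 3 / (6 * ℓ) + ε * s ^ 2 / 2) / ℓ := by
    rw [hD₂]
    exact norm_integral_defect₂_le hD₁cont hℓ hM hε fun u hu => hB₁ u hu
  have hcn : ‖c‖ ≤ M / ℓ := by
    have := hC1 0 (by simp)
    simpa [hc] using this
  rw [ha s, hb]
  refine (abs_triple_self_le (deriv X τ₀) c (D₁ s) D₂ s).trans ?_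
  have hB₁s := hB₁ s le_rfl
  have h0 : 0 ≤ ‖deriv X τ₀‖ := norm_nonneg _
  gcongr


/-- **Registered tools stub `stub_tameVerticalToolsB`** (line `zero-accretion-selection`): the conjunction of
`selfStrand_triple_le`, `deriv_sub_deriv_eq_integral`, `pos_sub_eq_integral`, `abs_triple_le`. [folklore] -/
theorem stub_tameVerticalToolsB :
    (∀ (X : ℝ → EuclideanSpace ℝ (Fin 3)) (τ₀ s M ℓ ε : ℝ), ContDiff ℝ 2 X → 0 < ℓ → 0 ≤ M → 0 ≤ ε →
      (∀ u, |u| ≤ |s| → ‖deriv (deriv X) (τ₀ + u)‖ ≤ M / ℓ) →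
      (∀ u, |u| ≤ |s| → ‖deriv (deriv X) (τ₀ + u) - deriv (deriv X) τ₀‖ ≤ (M * |u| / ℓ + ε) / ℓ) →
      |⟪cross (deriv X τ₀) (deriv X (τ₀ + s) - deriv X τ₀), X (τ₀ + s) - X τ₀ - s • deriv X τ₀⟫| ≤
        ‖deriv X τ₀‖ * (|s| * (M / ℓ) * ((M * |s| ^ 3 / (6 * ℓ) + ε * s ^ 2 / 2) / ℓ) +
          s ^ 2 / 2 * ((M * s ^ 2 / (2 * ℓ) + ε * |s|) / ℓ) * (M / ℓ) +
          ((M * s ^ 2 / (2 * ℓ) + ε * |s|) / ℓ) * ((M * |s| ^ 3 / (6 * ℓ) + ε * s ^ 2 / 2) / ℓ))) ∧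
    (∀ (X : ℝ → EuclideanSpace ℝ (Fin 3)) (τ₀ s : ℝ), ContDiff ℝ 2 X →
      deriv X (τ₀ + s) - deriv X τ₀ = ∫ u in (0:ℝ)..s, deriv (deriv X) (τ₀ + u)) ∧
    (∀ (X : ℝ → EuclideanSpace ℝ (Fin 3)) (τ₀ s : ℝ), ContDiff ℝ 2 X →
      X (τ₀ + s) - X τ₀ - s • deriv X τ₀ = ∫ u in (0:ℝ)..s, (deriv X (τ₀ + u) - deriv X τ₀)) ∧
    (∀ (u v w : EuclideanSpace ℝ (Fin 3)), |⟪cross u v, w⟫| ≤ ‖u‖ * ‖v‖ * ‖w‖) :=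
  ⟨fun _ τ₀ s _ _ _ hX hℓ hM hε hC1 hC2 => selfStrand_triple_le hX τ₀ s hℓ hM hε hC1 hC2,
    fun _ τ₀ s hX => deriv_sub_deriv_eq_integral hX τ₀ s,
    fun _ τ₀ s hX => pos_sub_eq_integral hX τ₀ s, abs_triple_le⟩

end Summit.NavierStokesRegularity.NavierStokesRegularity.Theorems.SkeletonEquilibrium.ZeroAccretionSelection
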